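import Summits.ABC.IUTFork.Cor312PinnedRegionsThreePins
import Summits.ABC.IUTFork.Cor312PilotKummerCompat
import HarnessLib

/-!
# [IUTchIII] Theorem 3.11 — CHARITABLE RE-TYPING D2: `Thm311Charitable_2` (branch D of B/C/D/E, rung LADDER-ABC:A2.D, team D2)

Record-only file (D-0012) of the abc-iut cell, seat abc-iut-D2-typ (team D2 typer; director-abc MINT-2 2026-08-26T05:19:22Z, cell
directive 05:19:55Z). TAKES NO SIDE on [IUTchIII] Cor. 3.12 or on any author. NO `Prop` FACT: every clause below is a READING
PREDICATE (`def … : Prop`) parametrised by the carriers of the pinned files, never asserted; `Thm311Charitable_2` is a HYPOTHESIS to be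
consumed as `(h : Thm311Charitable_2 S n qK)`. Typed ≠ proved. Source: S. Mochizuki, *Inter-universal Teichmüller theory III*, kurims
manuscript (May 2020) = `paper:url-4b091feeb646`, Theorem 3.11 pp. 153–159 and Remark 3.11.1 pp. 159–167, read in the cell librarian's
VERBATIM transcriptions `HOME/lit/THM311-VERBATIM.md`, `RMK3111-VERBATIM.md`, `PROP35-VERBATIM.md`, `DEF38-PROP39-VERBATIM.md` (render line
numbers `pNNNN.txt:Lk` quoted as "p. N l. k"). [claim: Mochizuki2012, status: disputed]

TASK (verbatim in substance). Re-type Thm. 3.11 (i) (multiradial representation), (ii) (log-Kummer correspondence incl. upper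
semi-compatibility and (Ind1)(Ind2)(Ind3)), (iii) (Θ×μ_LGP-link compatibility) and Rmk. 3.11.1 DIRECTLY FROM PRINT, choosing at every
ambiguity the reading MOST FAVOURABLE to deriving `S := Cor312Vol.PilotKummerIndRelated` (Cor312PinnedRegionsThreePins.lean:145) that the
words still bear; record every choice in `HOME/plan/D2/CHARITY-D2.md` (clause · sentence + page/line · weakest · strongest · chosen · why);
output `Thm311Charitable_2` as a conjunction of NAMED clause Props over the SAME carriers as the pinned files, so that
`Thm311Charitable_2 S P.n qK ∧ PinnedRegions3 S P ρ qK → PilotKummerIndRelated S P ρ qK` typechecks (team D2: (a) D2-prv derives or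
(b) D2-cx countermodels; (c) D-ref grades FAITHFUL | STRONGER-THAN-PRINT). BLIND RULE: written without reading team D1, the existing
typing's sources/design notes (`Thm311Sig`, `Thm311LogKummer`, `Thm311Multirad` were NOT opened), `plan/L6/FAITHFUL-A*-R2.md` or
`ref/REFEREE-FAITHFULNESS-A*.md`. CARRIER PROTOCOL: the carrier SIGNATURES (`ThetaIndex`, `LogShells`, `MRData`, `Column`, `GlobalDegrees`,
`LatticeSituation`, `Cor312.Setting`, the pins) were obtained by kernel `#print` through the allowed pinned files only (field names and
types, no docstrings); where this typing assigns a printed meaning to a carrier field (e.g. `Column.unitImage`, `ballImage`) the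
assignment is THIS typing's and is said in the clause docstring.

CHARITY POLICY. Charity is exercised where a sentence bears on `S` — the relation between the q-pilot's Kummer datum `qK` (column `n`,
bad places) and the Θ-data; everywhere else the PLAIN reading is typed (strength there buys nothing for `S` and costs faithfulness).
`qK` is the pinned files' UNINTERPRETED binder; this typing READS it as a Theorem-3.11 object: «the image, in the column-`n` bad-place
star packets `∏_{j∈𝔽_l^⋇} 𝓘^ℚ(^{S±_{j+1},j};^{n,∘}𝒟⊢_v)`, via the constant-monoid Kummer isomorphism of the first display of (ii)
(`Ψ_cns(^{n,m}𝔉_≻)_t ⥲ Ψ_cns(^{n,∘}𝔇_≻)_t`, p. 155 l. 10–13, symmetrised to the label set △ by (iii) (a), p. 156 l. 44–47), of the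
splitting monoid (the `q_v`, Def. 3.8 (i) p. 112 l. 55–63) of the CODOMAIN strip `^{n,m}𝔉⊩▶×μ_△` of the horizontal arrow
`(n−1,m) → (n,m)`» — the datum Cor. 3.12 calls "the image of a q-pilot object, relative to the relevant Kummer isomorphisms [cf. Theorem
3.11, (ii)]" (p. 174 l. 5–7) and which the pin (pq′) `QPinned` reads through `ρ`.

THE LOAD-BEARING CLAUSE is `III_c_KummerLinkSquare` — Thm. 3.11 (iii) (c), FINAL sentence, p. 158 l. 5–15, read as a COMMUTATIVE SQUARE
OF DATA up to (Ind1), (Ind2), (Ind3): [top] Kummer isomorphism + evaluation of (ii) (b) at `(n−1,m)`; [right] the poly-isomorphism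
`^{n−1,∘}ℜ ⥲ ^{n,∘}ℜ` of the first display of (iii) (c) (an (Ind1)/(Ind2)-move in the common container, by (i) final portion); [left] the
horizontal arrow, a FULL poly-isomorphism of 𝓕⊩▶×μ-prime-strips carrying splitting monoids to splitting monoids (Def. 3.8 (ii); Rmk. 3.8.1
"map Θ-pilot objects to q-pilot objects"); [bottom] the Kummer isomorphism at column `n` of the codomain strip's splitting monoid, i.e.
`qK`. "Compatible … up to (Ind1), (Ind2), (Ind3)" ⟹ `qK = Φ·Ψ^{Frob}_{(n−1,m′)}` for ONE `Φ ∈ ⟨(Ind1) ∪ (Ind2)⟩` and SOME `m′` ((Ind3)). This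
is the IDENTIFICATION-LEVEL (datum) reading; the weakest reading of the same sentence is its own gloss "in the sense that these
constructions are stabilized/equivariant/functorial with respect to arbitrary automorphisms of the domain and codomain" (typed separately
as `III_c_Stabilized`, which is a THEOREM of the carriers: `III_c_Stabilized_holds`). Print passages a referee must weigh AGAINST the square
reading: that gloss (p. 158 l. 11–15) and Rmk. 3.11.1 (iv) (APT) p. 162 l. 17–33 ("does not consist of a simple instance of transport of
some set-theoretic region … such possible regions cannot necessarily be directly compared with various structures in the codomain …
[cf.] Remark 3.9.5, (vii)"); passages FOR it: the sentence's own "i.e., up to the indeterminacies (Ind1), (Ind2), (Ind3)", Rmk. 3.11.1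
(ii) p. 159 l. 33 – p. 160 l. 5 (Thm. 3.11 (iii) "may be interpreted as an assertion to the effect that the functorial construction
algorithm for the Θ-pilot object up to (Ind1), (Ind2), (Ind3) … may be regarded as an algorithm whose input data is [the codomain
𝓕⊩▶×μ-prime-strip]"), (iii) (IPL) p. 160 l. 30–45, and Cor. 3.12 Step (xi-d) p. 183 l. 2–8. The (APT)-respecting HULL-LEVEL alternative
(Reading Y) is recorded as `Thm311Charitable_2H` (same Parts (i), (ii), (iii) (a)(b)(d) + the cell's `Cor312Vol.PilotKummerCompatHull` in
place of the square) for the team's second report line «(a-hull)»; by `Cor312PinnedLogShellOneRho` (d = 3) no hull-level clause yields `S`.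

KERNEL FACTS THAT BOUND THIS TYPING (pinned files, cited not restated): `Cor312Vol.pilotKummerIndRelated_of_pilotKummerCompat`,
`…_of_linkedGlue` (a datum-level square closes `S`, pins idle); `PinnedHonest.not_gapA''_of_scaled_of_absLogQPos` (on every pin-respecting,
honestly `j²`-scaled setting with `|log q| > 0`, `¬S`) — hence ANY typing from which `S` follows under the pins, this one included, is
INCONSISTENT with {pins, Step (x) invariance, honest `j²`-volumes, `AbsLogQPos`}; team D2 states that corollary next to any (a)-PROVED
line (DERIVE-D2.md §0d (F1)). Nothing here asserts any clause, the pins, `S`, or Cor. 3.12; locates / conditionally verifies only.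
-/

noncomputable section

open Set

namespace Summit.ABC.IUTFork.Charitable.D2

open Thm311 Cor312 Cor312Vol Literature.IUT.LogThetaLattice

variable {T : ThetaIndex} (S : LatticeSituation T)

/-! ## Part (i) — Multiradial Representation (p. 153 l. 18 – p. 155 l. 8)

Data (a), (b), (c) of column `n` ARE the carrier `S.D n : MRData S.L` (packets `S.L.Packet j v_ℚ` with integral structures `shellPk` and
log-volumes `Adm`/`logvol` = (a); the splitting monoid `Ψ v ⊆ ∏_{j∈𝔽_l^⋇} 𝓘^ℚ(^{S±_{j+1},j};^{n,∘}𝒟⊢_v)` with its multiplicative action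
`act` = (b); the number fields `Mmod j ⊆ 𝓘^ℚ(^{S±_{j+1}};^{n,∘}𝒟⊢_{𝕍_ℚ})` and the global Frobenioids `S.G n j` = (c)); "(Ind1) the
indeterminacies induced by the automorphisms of the procession of 𝒟⊢-prime-strips" and "(Ind2) … induced by … independent copies of Ism
… on each of the direct summands of the j+1 factors" (p. 154 l. 43–63) ARE the carrier families `S.L.Ind1Family`, `S.L.Ind2Family`, and
"^{n,∘}ℜ^LGP … regarded up to (Ind1), (Ind2)" IS the orbit `S.RLGP n = (S.D n).RLGP` (`EqvGen` of single (Ind1)/(Ind2)-moves). -/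

/-- **(i) (a) — (Ind1)/(Ind2)-invariance of admissibility and mono-analytic log-volume** (p. 153 l. 27–39: the packets are "equipped
with the procession-normalized mono-analytic log-volumes of Proposition 3.9, (ii)"; Prop. 3.9 (ii) p. 116 l. 28 – p. 117 l. 7: "these
log-volumes may be constructed via a functorial algorithm from the 𝒟⊢-prime-strips" and "by replacing 𝒟⊢ by 𝔉⊢×μ … one obtains a similar
theory … compatible"). PLAIN reading: admissibility and log-volume on column `n`'s packets are invariant under each (Ind1)/(Ind2)
generator (the shape of the inline Step (x) hypotheses `hAdm`/`hvol` of `Cor312PinnedRegionsHonest`, here for every column;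
`MRData.LogvolInvariant` is the carriers' name for the volume half). [claim: Mochizuki2012, status: disputed] -/
@[claim "Mochizuki2012" "disputed"]
def I_a_IndInvariant : Prop :=
  ∀ n : ℤ, (S.D n).LogvolInvariant ∧
    ∀ Φ ∈ S.L.Ind1Family ∪ S.L.Ind2Family, ∀ (j : T.Label) (vQ : T.VQ) (B : Set (S.L.Packet j vQ)),
      (S.D n).Adm j vQ B ↔ (S.D n).Adm j vQ (Φ j vQ '' B)

/-- **(i) (c) — global degrees computed by log-volumes** (p. 154 l. 33–42: "natural isomorphisms between the associated global
non-realified/realified Frobenioids … whose associated 'global degrees' may be computed by means of the log-volumes of (a) [cf.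
Proposition 3.9, (iii)]"; Prop. 3.9 (iii) p. 117 l. 8–48: "by adding the log-volumes … [all but finitely many of which are zero!] at the
various `v_ℚ ∈ 𝕍_ℚ`, one obtains a global log-volume … equal to the degree of the arithmetic line bundle determined by `J` …, relative to a
suitable normalization"). PLAIN reading over the carrier `S.G n j : GlobalDegrees S.L j` (`natIso : ObjMOD ≃ Objmod`, `deg`, `region`):
the region of an object is admissible at every `v_ℚ`, has zero log-volume at all but finitely many `v_ℚ`, and its degree IS the sum
(print's "suitable normalization" is taken to be the carrier's `deg`). [claim: Mochizuki2012, status: disputed] -/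
@[claim "Mochizuki2012" "disputed"]
def I_c_GlobalDegrees : Prop :=
  ∀ (n : ℤ) (j : T.LabelStar) (x : (S.G n j).Objmod),
    (∀ vQ : T.VQ, (S.D n).Adm j.1 vQ ((S.G n j).region x vQ)) ∧
    (Function.support fun vQ : T.VQ => (S.D n).logvol j.1 vQ ((S.G n j).region x vQ)).Finite ∧
    (S.G n j).deg x = ∑ᶠ vQ : T.VQ, (S.D n).logvol j.1 vQ ((S.G n j).region x vQ)

/-- **(i), final portion — functoriality and the permutation symmetries of the étale-picture** (p. 154 l. 64 – p. 155 l. 8: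
"^{n,∘}ℜ^LGP may be constructed via an algorithm in the procession of 𝒟⊢-prime-strips Prc(^{n,∘}𝔇⊢_T) that is functorial with respect
to isomorphisms of processions of 𝒟⊢-prime-strips. For `n, n′ ∈ ℤ`, the permutation symmetries of the étale-picture … induce compatible
poly-isomorphisms Prc(^{n,∘}𝔇⊢_T) ⥲ Prc(^{n′,∘}𝔇⊢_T); ^{n,∘}ℜ^LGP ⥲ ^{n′,∘}ℜ^LGP which are, moreover, compatible with the
poly-isomorphisms ^{n,∘}𝔇⊢_0 ⥲ ^{n′,∘}𝔇⊢_0 induced by the bi-coricity poly-isomorphisms of Theorem 1.5, (iii)"). WEAKEST: some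
bijection between the two orbits. STRONGEST (chosen; bears on `S` as the side input "`S.D (n−1) ∈ S.RLGP n`"): the carriers identify all
columns' containers through the bi-coric 0-labelled strips (ONE `S.L` for every `n`), and a poly-isomorphism of ℜ^LGP-data induced by
isomorphisms OF PROCESSIONS is, inside that container, a chain of (Ind1)/(Ind2)-moves — so the column-`n′` data lie in the column-`n`
orbit: the orbits COINCIDE. [claim: Mochizuki2012, status: disputed] -/
@[claim "Mochizuki2012" "disputed"]
def I_PermSymmetric : Prop := ∀ n n' : ℤ, S.D n' ∈ S.RLGP n

/-- **Part (i)** as typed: (a)-invariance ∧ (c)-degrees ∧ permutation symmetry ((a), (b), (Ind1), (Ind2), ℜ^LGP are carriers).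
[claim: Mochizuki2012, status: disputed] -/
@[claim "Mochizuki2012" "disputed"]
def PartI : Prop := I_a_IndInvariant S ∧ I_c_GlobalDegrees S ∧ I_PermSymmetric S

/-! ## Part (ii) — log-Kummer Correspondence (p. 155 l. 9 – p. 156 l. 39)

"For `n, m ∈ ℤ`, the Kummer isomorphisms … induce isomorphisms between the vertically coric data (a), (b), (c) of (i) [… not yet
subjected to the indeterminacies (Ind1), (Ind2)] and the corresponding data arising from each Θ±ell NF-Hodge theater ^{n,m}𝓗𝓣" — the
Frobenius-like data at `(n, m)` READ IN the column-`n` container ARE the carrier `S.col n : Column S.L` (fields indexed by `m`). -/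

/-- **(ii) (a) — packets, compatible with log-volumes; "[precisely!] compatible" as `m` varies** (p. 155 l. 30–70: "isomorphisms with
local mono-analytic tensor packets and their ℚ-spans … all of which are compatible with the respective log-volumes [cf. Proposition
3.9, (ii)]"; p. 156 l. 35–39: "as one varies `m ∈ ℤ`, the isomorphisms of (a) are [precisely!] compatible, relative to the log-links of
the n-th column …, with the respective log-volumes [cf. Proposition 3.9, (iv)]"). PLAIN reading (this typing reads `Column.frobAdm m` /
`frobLogvol m` as the Frobenius-like admissibility / log-volume of `(n,m)` transported to the column-`n` packets by the (ii) (a)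
isomorphism at `m`): they coincide with the étale-like ones, for EVERY `m`. [claim: Mochizuki2012, status: disputed] -/
@[claim "Mochizuki2012" "disputed"]
def II_a_PacketKummer : Prop :=
  ∀ (n m : ℤ) (j : T.Label) (vQ : T.VQ) (A : Set (S.L.Packet j vQ)),
    ((S.col n).frobAdm m j vQ A ↔ (S.D n).Adm j vQ A) ∧
    ((S.D n).Adm j vQ A → (S.col n).frobLogvol m j vQ A = (S.D n).logvol j vQ A)

/-- **(ii) (Ind3) — upper semi-compatibility** (p. 156 l. 25–34: "(Ind3) as one varies `m ∈ ℤ`, the isomorphisms of (a) are 'upper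
semi-compatible', relative to the log-links of the n-th column …, in a sense that involves certain natural inclusions '⊆' at `v_ℚ ∈
𝕍_ℚ^non` and certain natural surjections '↠' at `v_ℚ ∈ 𝕍_ℚ^arc` — cf. Proposition 3.5, (ii), (a), (b)"; Prop. 3.5 (ii) (a) p. 104 l.
38 – p. 105 l. 8: the log-shell "contains the images of the … groups of units … via both (1) … the Kummer isomorphisms … and (2) … the
pre-composite of these Kummer isomorphisms with the `m′`-th iterates of the log-links, for `m′ ≥ 1`"; (b) p. 105 l. 9–29: at archimedean
`v_ℚ` the closed unit ball "contains the image … of both (1) the groups of units … and (2) the closed balls of radius π"). PLAIN reading,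
as INCLUSIONS (this typing reads `Column.unitImage m k j v_ℚ` as the image in the packet of the Galois-invariant units of `(n,m)` via the
`k`-th log-iterate pre-composed Kummer isomorphism, `k ≥ 0`, and `Column.ballImage m j v_ℚ` as the image of the closed balls of radius
π, archimedean `v_ℚ`): all these images lie in the log-shell `shellPk` of the column-`n` packet — "⊆", no equality, no surjectivity
clause (the '↠' concerns the log-link's domain of definition, not a further containment). [claim: Mochizuki2012, status: disputed] -/
@[claim "Mochizuki2012" "disputed"]
def II_Ind3_UpperSemiCompat : Prop :=
  (∀ (n m : ℤ) (k : ℕ) (j : T.Label) (vQ : T.VQ), (S.col n).unitImage m k j vQ ⊆ (S.D n).shellPk j vQ) ∧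
  (∀ (n m : ℤ) (j : T.Label) (vQ : T.VQ), ¬ T.IsNon vQ → (S.col n).ballImage m j vQ ⊆ (S.D n).shellPk j vQ)

/-- **(ii) (b) — splitting monoids at `v ∈ 𝕍^bad`, mutually compatible in `m` with NO indeterminacy** (p. 155 l. 71–77: "isomorphisms
of splitting monoids Ψ⊥_{𝔉_LGP}(^{n,m}𝓗𝓣)_v ⥲ Ψ⊥_LGP(^{n,∘}𝓗𝓣^{𝒟})_v"; p. 156 l. 10–17: "as one varies `m ∈ ℤ`, the various isomorphisms of
(b) … are mutually compatible with one another, relative to the log-links of the n-th column …, in the sense that the only portions …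
possibly related to one another via the log-links consist of roots of unity … [… i.e., to no indeterminacy!]"). STRONGEST = PLAIN reading
in the carriers (`Column.frobΨ m` = the Kummer image of the Frobenius-like splitting monoid of `(n,m)` in the column-`n` star packets): it
IS the étale-like splitting monoid, for every `m` — the per-column form of the pinned files' `Column.KummerB` (`kummerB_of_II_b`).
[claim: Mochizuki2012, status: disputed] -/
@[claim "Mochizuki2012" "disputed"]
def II_b_SplittingKummer : Prop :=
  ∀ (n m : ℤ) (v : T.V) (hv : v ∈ T.Vbad), (S.col n).frobΨ m v hv = (S.D n).Ψ v hv

/-- **(ii) (c) — number fields, mutually compatible in `m` for "MOD"** (p. 155 l. 78 – p. 156 l. 9: "isomorphisms of number fields and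
global non-realified/realified Frobenioids (^{n,m}𝕄⊛_MOD)_j ⥲ 𝕄⊛_MOD(^{n,∘}𝓗𝓣^{𝒟})_j; … which are compatible with the respective natural
isomorphisms between 'MOD'- and 'mod'-subscripted versions"; p. 156 l. 10–24: the first line is mutually compatible as `m` varies, which
"implies a corresponding mutual compatibility between the isomorphisms … that involve the subscript 'MOD' [but not … 'mod'!]"). PLAIN
reading (this typing reads `Column.frobMmod m j` as the Kummer image of the number field `(^{n,m}𝕄⊛_MOD)_j = (^{n,m}𝕄⊛_mod)_j` in the global
packet): it IS the étale-like copy `Mmod j`, for every `m`; the global realified Frobenioid isomorphisms ^{n,m}𝒞⊩_LGP ⥲ 𝒞⊩_LGP(^{n,∘}𝓗𝓣^{𝒟})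
are the carrier bijections `Column.kumLGP m`, `kumLgp m` (data; no 'mod'-side `m`-compatibility is typed, as print excludes it).
[claim: Mochizuki2012, status: disputed] -/
@[claim "Mochizuki2012" "disputed"]
def II_c_NumberFieldKummer : Prop :=
  ∀ (n m : ℤ) (j : T.LabelStar), (S.col n).frobMmod m j = (S.D n).Mmod j

/-- **Part (ii)** as typed. [claim: Mochizuki2012, status: disputed] -/
@[claim "Mochizuki2012" "disputed"]
def PartII : Prop :=
  II_a_PacketKummer S ∧ II_Ind3_UpperSemiCompat S ∧ II_b_SplittingKummer S ∧ II_c_NumberFieldKummer S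

/-! ## Part (iii) — Θ×μ_LGP-Link Compatibility (p. 156 l. 40 – p. 159 l. 3)

"The various Kummer isomorphisms of (ii) satisfy compatibility properties with the various horizontal arrows — i.e., Θ×μ_LGP-links — of
the LGP-Gaussian log-theta-lattice under consideration as follows". The horizontal arrow INTO column `n` is `(n−1, m) → (n, m)`
(Def. 3.8 (iii)); clauses are stated for that arrow, for every `n`. -/

/-- **(iii) (a), (b) — the unit (𝓕⊢×μ) portion across the link** (p. 156 l. 44 – p. 157 l. 25: "(a) … a Kummer isomorphism
^{n,m}𝔉⊢×μ_△ ⥲ 𝔉⊢×μ_△(^{n,∘}𝔇⊢_△) … Relative to this Kummer isomorphism, the full poly-isomorphism of 𝓕⊢×μ-prime-strips 𝔉⊢×μ_△(^{n,∘}𝔇⊢_△) ⥲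
𝔉⊢×μ_△(^{n+1,∘}𝔇⊢_△) is compatible with the full poly-isomorphism … ^{n,m}𝔉⊢×μ_△ ⥲ ^{n+1,m}𝔉⊢×μ_△ induced … by the horizontal arrows"; (b) the
same for the 𝓕⊢×μ_env-strips). Container-level reading (the unit portion's footprint in the packets is the mono-analytic log-shell
`shellPk`; an isomorphism of 𝓕⊢×μ-prime-strips acts on the common container through ⟨(Ind1) ∪ (Ind2)⟩, p. 154 l. 43–63): the column-`n`
log-shells are ONE ⟨(Ind1) ∪ (Ind2)⟩-translate of the column-`(n−1)` log-shells. Irrelevant to `S` (the `q_v` live in the value-group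
portion 𝓕⊩▶, not in 𝓕⊢×μ). [claim: Mochizuki2012, status: disputed] -/
@[claim "Mochizuki2012" "disputed"]
def III_ab_UnitPortionLink : Prop :=
  ∀ n : ℤ, ∃ Φ ∈ Subgroup.closure (S.L.Ind1Family ∪ S.L.Ind2Family),
    ∀ (j : T.Label) (vQ : T.VQ), (S.D n).shellPk j vQ = Φ j vQ '' (S.D (n - 1)).shellPk j vQ

/-- **(iii) (c), first sentence + the "in the sense that" gloss — stabilized/equivariant/functorial** (p. 157 l. 26 – p. 158 l. 5 and
p. 158 l. 11–15: the algorithmic constructions "are compatible with the horizontal arrows …, in the sense that these constructions are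
stabilized/equivariant/functorial with respect to arbitrary automomorphisms [sic] of the domain and codomain of these horizontal
arrows"). This is the WEAKEST reading of "compatible" and is typed on its own: the orbit of outputs ^{n,∘}ℜ^LGP is stable under every
(Ind1)/(Ind2) generator (automorphisms of the strips act through them). In the carriers it is a THEOREM (`III_c_Stabilized_holds`: the
orbit is an `EqvGen`-class), recorded so that the referee sees what the gloss alone supplies: nothing about `qK`.
[claim: Mochizuki2012, status: disputed] -/
@[claim "Mochizuki2012" "disputed"]
def III_c_Stabilized : Prop :=
  ∀ (n : ℤ) (Φ : S.L.PacketAut), Φ ∈ S.L.Ind1Family ∪ S.L.Ind2Family → ∀ D' ∈ S.RLGP n, D'.map Φ ∈ S.RLGP n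

/-- **(iii) (c), FINAL sentence — THE LOAD-BEARING CLAUSE, read as a commutative square of Kummer data up to (Ind1), (Ind2), (Ind3)**
(p. 158 l. 5–15, verbatim: "Finally, the algorithmic construction of the poly-isomorphisms of the first display above [^{n,∘}ℜ ⥲ ^{n+1,∘}ℜ],
the various related Kummer isomorphisms, and the various evaluation maps implicit in the portion of the log-Kummer correspondence
discussed in (ii), (b), are compatible with the horizontal arrows of the LGP-Gaussian log-theta-lattice under consideration, i.e., up
to the indeterminacies (Ind1), (Ind2), (Ind3) described in (i), (ii) [cf. also the discussion of Remark 3.11.4 below], in the sense that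
these constructions are stabilized/equivariant/functorial with respect to arbitrary automomorphisms [sic] of the domain and codomain of
these horizontal arrows"). For the arrow `(n−1,m) → (n,m)`: WEAKEST reading = `III_c_Stabilized`. STRONGEST reading the words
"compatible with the horizontal arrows … up to the indeterminacies (Ind1), (Ind2), (Ind3)" bear (CHOSEN — the one place where charity
decides `S`): the square [Ψ⊥_{𝔉_LGP}(^{n−1,m}) —Kummer+evaluation of (ii)(b)→ column-(n−1) container —^{n−1,∘}ℜ ⥲ ^{n,∘}ℜ→ column-`n`
container] versus [Ψ⊥_{𝔉_LGP}(^{n−1,m}) —horizontal arrow (full poly-iso of 𝓕⊩▶×μ-strips: splitting monoid ↦ splitting monoid, Θ-pilot ↦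
q-pilot, Rmk. 3.8.1)→ splitting monoid of ^{n,m}𝔉⊩▶×μ_△ —Kummer at column `n`→ `qK`] COMMUTES up to one `Φ ∈ ⟨(Ind1) ∪ (Ind2)⟩` and the
row index ((Ind3) = the variation in `m`): `qK = Φ · Ψ^{Frob}_{(n−1,m′)}`. DATUM level, uniform in `v ∈ 𝕍^bad`. With `I_PermSymmetric`
and `II_b_SplittingKummer` it yields `S` with the pins IDLE (team D2-prv, kit K2 `pilotKummerIndRelated_of_frobDatum`; cf. the cell's
`Cor312Vol.pilotKummerIndRelated_of_linkedGlue`, `PilotKummerCompat` = the same square with `n′ = n`). CHARITY-D2.md row III-c-2.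
[claim: Mochizuki2012, status: disputed] -/
@[claim "Mochizuki2012" "disputed"]
def III_c_KummerLinkSquare (n : ℤ) (qK : ∀ v : T.V, v ∈ T.Vbad → Set (S.L.StarPacket v)) : Prop :=
  ∃ Φ ∈ Subgroup.closure (S.L.Ind1Family ∪ S.L.Ind2Family), ∃ m : ℤ,
    ∀ (v : T.V) (hv : v ∈ T.Vbad), qK v hv = S.L.starAut Φ v '' (S.col (n - 1)).frobΨ m v hv

/-- **(iii) (d) — the number-field / κ-sol portion across the link** (p. 158 l. 16 – p. 159 l. 3: the Kummer isomorphisms of the first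
display of (ii) and the poly-isomorphisms of the κ-sol data "are compatible … with the full poly-isomorphism … ^{n,m}𝔉⊢×μ_△ ⥲ ^{n+1,m}𝔉⊢×μ_△
… in the sense that these constructions are stabilized/equivariant/functorial …. Finally, … the portion of the log-Kummer
correspondence discussed in (ii), (c), are compatible with the horizontal arrows …, i.e., up to the indeterminacies (Ind1), (Ind2),
(Ind3)"). Read with the SAME square as (c) on the (ii) (c) data the carriers hold (the number fields in the global packets): the
column-`n` copies are one ⟨(Ind1) ∪ (Ind2)⟩-translate of the column-`(n−1)` copies (the object-level part — ^{n,m}𝒞⊩ versus the pins'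
`P.Ob`-types — has no common carrier and is not typed). Irrelevant to `S`. [claim: Mochizuki2012, status: disputed] -/
@[claim "Mochizuki2012" "disputed"]
def III_d_NumberFieldLink : Prop :=
  ∀ n : ℤ, ∃ Φ ∈ Subgroup.closure (S.L.Ind1Family ∪ S.L.Ind2Family),
    ∀ j : T.LabelStar, (S.D n).Mmod j = S.L.globalAut Φ j.1 '' (S.D (n - 1)).Mmod j

/-- **Part (iii)** for the arrow into column `n`, with `qK` the codomain datum (module docstring). [claim: Mochizuki2012, status: disputed] -/
@[claim "Mochizuki2012" "disputed"]
def PartIII (n : ℤ) (qK : ∀ v : T.V, v ∈ T.Vbad → Set (S.L.StarPacket v)) : Prop :=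
  III_ab_UnitPortionLink S ∧ III_c_Stabilized S ∧ III_c_KummerLinkSquare S n qK ∧ III_d_NumberFieldLink S

/-! ## The charitable typing -/

/-- **`Thm311Charitable_2` — [IUTchIII] Theorem 3.11 (i) ∧ (ii) ∧ (iii), team D2's maximally-charitable reading** over the pinned
carriers: `S : Thm311.LatticeSituation T` (all columns), `n : ℤ` the codomain column of the horizontal arrow the Corollary reads (`P.n`
of a `Cor312.Setting`), `qK` the codomain strip's bad-place Kummer datum (module docstring). A HYPOTHESIS, never asserted; usage
`Thm311Charitable_2 S P.n qK ∧ PinnedRegions3 S P ρ qK → PilotKummerIndRelated S P ρ qK`. Faithfulness of each conjunct: CHARITY-D2.md;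
the referee's verdict (FAITHFUL | STRONGER-THAN-PRINT) is NOT anticipated here. [claim: Mochizuki2012, status: disputed] -/
@[claim "Mochizuki2012" "disputed"]
def Thm311Charitable_2 (n : ℤ) (qK : ∀ v : T.V, v ∈ T.Vbad → Set (S.L.StarPacket v)) : Prop :=
  PartI S ∧ PartII S ∧ PartIII S n qK

/-! ## Remark 3.11.1 (pp. 159–167) — the author's glosses, typed as readings (NOT conjuncts of `Thm311Charitable_2`) -/

/-- **Rmk. 3.11.1 (ii) — input-functoriality / the codomain column is "coric"** (p. 159 l. 33 – p. 160 l. 22: Thm. 3.11 (iii) "may be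
interpreted as an assertion to the effect that the functorial construction algorithm for the Θ-pilot object up to … (Ind1), (Ind2),
(Ind3) … may be regarded as an algorithm whose input data is an 𝓕⊩▶×μ-prime-strip [i.e., the … strip that appears in the codomain of the
Θ-link], and whose functoriality is with respect to arbitrary isomorphisms of the 𝓕⊩▶×μ-prime-strips that appear as input data").
Container reading: the output orbit computed from the codomain strip (column `n`) is the output orbit computed from the domain strip
(column `n−1`) — the orbits coincide; a consequence of `I_PermSymmetric` (team D2-prv). [claim: Mochizuki2012, status: disputed] -/
@[claim "Mochizuki2012" "disputed"]
def Rmk3111_ii_InputFunctorial : Prop := ∀ n : ℤ, S.RLGP n = S.RLGP (n - 1)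

/-- **Rmk. 3.11.1 (iii) (IPL) — input prime-strip link, STRONG container reading** (p. 160 l. 30–45: "This output data is constructed
in such a way that it is linked/related, via full poly-isomorphisms of 𝓕⊩▶×μ-prime-strips induced by operations in the algorithm, to the
input data prime-strip, i.e., the 'coric'/'fixed' q-pilot 𝓕⊩▶×μ-prime-strip, equipped with its rigidifying arithmetic holomorphic
structure"). WEAKEST: an abstract strip isomorphism per output (no container content). STRONGEST (the reading under which (IPL) bears on
`S`; "equipped with its rigidifying arithmetic holomorphic structure" read as "as Kummer-embedded in column `n`"): SOME output datum
`D′ ∈ ^{n,∘}ℜ^LGP` has splitting-monoid datum EQUAL to `qK`. Under `I_PermSymmetric ∧ II_b_SplittingKummer` this follows from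
`III_c_KummerLinkSquare` (team D2-prv), so it adds no strength to `Thm311Charitable_2`; it is `S` at datum level before the `ρ`-reading.
[claim: Mochizuki2012, status: disputed] -/
@[claim "Mochizuki2012" "disputed"]
def Rmk3111_iii_IPL (n : ℤ) (qK : ∀ v : T.V, v ∈ T.Vbad → Set (S.L.StarPacket v)) : Prop :=
  ∃ D' ∈ S.RLGP n, ∀ (v : T.V) (hv : v ∈ T.Vbad), qK v hv = D'.Ψ v hv

/-- **Reading Y — the (APT)-respecting, HULL-LEVEL alternative to the square** (Rmk. 3.11.1 (iv) (APT) p. 162 l. 17–33: the parallel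
transport "does not consist of a simple instance of transport of some set-theoretic region … via some set-theoretic function … such
possible regions cannot necessarily be directly compared with various structures in the codomain of the Θ-link … such comparisons
typically require the application of further techniques, as discussed in Remark 3.9.5, (vii)" [= holomorphic hull + log-volume]; Cor.
3.12 Step (xi-d) p. 183 l. 2–8 "followed by formation of the holomorphic hull"). Typed BY NAME as the cell's
`Cor312Vol.PilotKummerCompatHull` ("`ρ qK ⊆ ^{n,∘}𝒰_{j,v_ℚ}` in every packet"); `Thm311Charitable_2H` = Parts (i), (ii), (iii) (a)(b)(d) +
the gloss + Reading Y. It gives the typed Corollary under `BridgeHyps ∧ QPinned` (`statement_of_pilotKummerCompatHull`) but NOT `S`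
(`Cor312PinnedLogShellOneRho`, d = 3). For the team's report line (a-hull). [claim: Mochizuki2012, status: disputed] -/
@[claim "Mochizuki2012" "disputed"]
def Thm311Charitable_2H (P : Cor312.Setting S.toSituation)
    (ρ : (∀ v : T.V, v ∈ T.Vbad → Set (S.L.StarPacket v)) → ∀ (j : T.Label) (vQ : T.VQ), Set (S.L.Packet j vQ))
    (qK : ∀ v : T.V, v ∈ T.Vbad → Set (S.L.StarPacket v)) : Prop :=
  PartI S ∧ PartII S ∧ (III_ab_UnitPortionLink S ∧ III_c_Stabilized S ∧ III_d_NumberFieldLink S) ∧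
    PilotKummerCompatHull S P ρ qK

/-! ## Bookkeeping (no clause is proved; these are unfoldings and the one carrier-level tautology) -/

/-- `II_b_SplittingKummer` is the pinned files' `Column.KummerB` at every column. [folklore] -/
theorem kummerB_of_II_b (h : II_b_SplittingKummer S) (n : ℤ) : (S.col n).KummerB (S.D n) := fun m v hv => h n m v hv

/-- The "stabilized/equivariant/functorial" gloss holds in the carriers outright: the orbit ^{n,∘}ℜ^LGP is closed under single
(Ind1)/(Ind2)-moves by its definition as an `EqvGen`-class. [folklore] -/
theorem III_c_Stabilized_holds : III_c_Stabilized S := by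
  intro n Φ hΦ D' hD'
  have hΦ' : Φ ∈ S.L.Ind1Family ∨ Φ ∈ S.L.Ind2Family := hΦ
  exact Relation.EqvGen.trans _ _ _ hD' (Relation.EqvGen.rel _ _ ⟨Φ, hΦ', rfl⟩)

/-- Unfolding for the team: the conjuncts of `Thm311Charitable_2` that mention `qK` are exactly `III_c_KummerLinkSquare`; the side
inputs a derivation of `S` consumes are `I_PermSymmetric` (column `n−1` data in the column-`n` orbit) and `II_b_SplittingKummer` at
column `n−1`. [folklore] -/
theorem charitable_2_square {n : ℤ} {qK : ∀ v : T.V, v ∈ T.Vbad → Set (S.L.StarPacket v)}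
    (h : Thm311Charitable_2 S n qK) :
    I_PermSymmetric S ∧ II_b_SplittingKummer S ∧ III_c_KummerLinkSquare S n qK :=
  ⟨h.1.2.2, h.2.1.2.2.1, h.2.2.2.2.1⟩

/-- The hull-level variant drops exactly the square: `Thm311Charitable_2 ∧ PilotKummerCompatHull → Thm311Charitable_2H`. [folklore] -/
theorem charitable_2H_of_charitable_2 {P : Cor312.Setting S.toSituation}
    {ρ : (∀ v : T.V, v ∈ T.Vbad → Set (S.L.StarPacket v)) → ∀ (j : T.Label) (vQ : T.VQ), Set (S.L.Packet j vQ)}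
    {qK : ∀ v : T.V, v ∈ T.Vbad → Set (S.L.StarPacket v)}
    (h : Thm311Charitable_2 S P.n qK) (hY : PilotKummerCompatHull S P ρ qK) : Thm311Charitable_2H S P ρ qK :=
  ⟨h.1, h.2.1, ⟨h.2.2.1, h.2.2.2.1, h.2.2.2.2.2⟩, hY⟩

end Summit.ABC.IUTFork.Charitable.D2

end

/-! ## Appendix A (append-only, abc-iut-D2-typ 2026-08-26T07:0xZ) — LOCATOR CONCORDANCE for pp. 153–159

The render line numbers ("p. N l. k") quoted in the docstrings above for the STATEMENT of Theorem 3.11 (pp. 153–159) follow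
the cell's first transcription `HOME/lit/THM311-VERBATIM.md`; the cell's CURRENT render
`HOME/lit/renders/IUTchIII-kurims-url-4b091feeb646/pNNNN.txt` (= the blind-safe pack `HOME/lit/THM311-VERBATIM-BLIND.md`, sha16
330f852245f951b6) numbers the same sentences a few lines later. Pages are unchanged; the sentences quoted are unchanged. Concordance
(docstring locator → current render), checked against the render by this seat:
(i) header p. 153 l. 18 – p. 155 l. 8 → p. 153 l. 16 – p. 155 l. 9 · (i)(a) p. 153 l. 27–39 → l. 28–43 · (i)(c) "global degrees …
log-volumes of (a)" p. 154 l. 33–42 → l. 44–47 · (Ind1)(Ind2) p. 154 l. 43–63 → l. 48–66 · (i) final portion p. 154 l. 64 – p. 155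
l. 8 → p. 154 l. 67 – p. 155 l. 9 · (ii) first display `Ψ_cns` p. 155 l. 10–13 → l. 10–14 · (ii)(a) p. 155 l. 30–70 → l. 35–78 ·
(ii)(b) p. 155 l. 71–77 → l. 79–85 · (ii)(c) p. 155 l. 78 – p. 156 l. 9 → p. 155 l. 86 – p. 156 l. 18 · (ii) mutual compatibility
"no indeterminacy!" / "MOD … but not … mod" p. 156 l. 10–24 → l. 19–31 · (Ind3) p. 156 l. 25–34 → l. 33–40 · "[precisely!]"
p. 156 l. 35–39 → l. 41–43 · (iii) header p. 156 l. 40–43 → l. 44–48 · (iii)(a) p. 156 l. 44 – p. 157 l. 2 → p. 156 l. 49 – p. 157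
l. 3 · (iii)(b) p. 157 l. 3–25 → l. 4–38 · (iii)(c) p. 157 l. 26 – p. 158 l. 15 → p. 157 l. 39 – p. 158 l. 15 (first sentence's
"algorithmic construction" p. 157 l. 53; the "stabilized/equivariant/functorial" gloss p. 158 l. 2–6 and l. 12–15; THE LOAD-BEARING
FINAL SENTENCE p. 158 l. 5–15 → p. 158 l. 6–15, unchanged in substance) · (iii)(d) p. 158 l. 16 – p. 159 l. 3 → l. 16 – p. 159 l. 4 ·
Proof p. 159 l. 4–6 → l. 5–7. The locators for Rmk. 3.11.1 (p. 159 l. 8 ff.: (ii) "may be interpreted as an assertion" p. 159 l. 41 –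
p. 160 l. 7, (IPL) p. 160 l. 30–45, (SHE) p. 161 l. 23 ff., (APT) p. 162 l. 17–33, (viii) "value group portions … held rigid"
p. 166 l. 19 ff.), for Prop. 3.5 (pp. 103–106), Def. 3.8 / Rmk. 3.8.1 (p. 112 l. 50–62, p. 114 l. 68–70), Prop. 3.9 (pp. 115–118),
Cor. 3.12 (p. 174 l. 8) and Step (xi-d) (p. 183 l. 5) already agree with the current render. No clause, reading or grade claim
is affected. -/
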